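import Mathlib
import HarnessLib
import Summits.CriticalPhenomena.SAWScalingLimit.Theses.SAWSpinMonotone
import Summits.CriticalPhenomena.SAWScalingLimit.Theses.SAWDevelopingMap
import Literature.Barriers.CriticalPhenomena.ParafermionicHalfCauchyRiemann

/-!
# Vocabulary of line `eight_fifths_primitive` for crux `QCIdentification` (stmt-CriticalPhenomena-16772)

Route `SAWSpinMonotone` (sub-problem `CriticalPhenomena/SAWScalingLimit`), crux
`Summit.CriticalPhenomena.SAWScalingLimit.Theses.SAWSpinMonotone.QCIdentification`
(`:= (K) → (M) → HexObservableLimit`, item stmt-CriticalPhenomena-16772; one node with the sibling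
item stmt-CriticalPhenomena-8298 `SAWDevelopingMap.QCIdentification`, `sameNode : _ ↔ _ := Iff.rfl`).
This file is the **definitions module** of the checked skeleton
`Cruxes/QCIdentification/Lines/eight_fifths_primitive.lean` (strategist
`planner-cstrat-stmt-CriticalPhenomena-16772-b1-0`, lead `prover-line-stmt-CriticalPhenomena-16772-0`,
`ledger skeleton check` OK, seven registered stubs `stub_noBranching`, `stub_subsequentialLimits`,
`stub_boundaryPhaseLaw`, `stub_rayCondition`, `stub_rayRigidity`, `stub_lateralUniversality`,
`stub_boundaryAmplitude`; the first two and the last two are shared VERBATIM with the birth cuts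
`Lines/birth_SAWSpinMonotone.lean` / `Lines/birth.lean` of both items): it carries, sorry-free, the
skeleton's VOCABULARY — the abbreviated observable `Fobs`, the explicit neighbours `hexNbr`, the
`∂H`-mode `modeSum`, the admissible data `Admissible` (verbatim the hypotheses of the target
`HexObservableLimit`), the averaged observable `bulkAverage` and the limit shape `shapeIntegral`, the
ray solutions `RaySolution` of the spin-`5/8` Smirnov boundary problem, and the statements
`NoBranching`, `ZigzagLateralUniversality`, `SubsequentialLimits`, `BoundaryRigidity`,
`ProjectiveShape`, `BoundaryAmplitude`, `BoundaryPhaseLaw`, `RayCondition`, `RayRigidity` together with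
the seven registered stub statements `Sig.stub_*` — so that the stub helper files
`Theorems/SAWSpinMonotoneQCIdentification<StubName>.lean` (each proving
`theorem <stubName> : <signature>` by name, `--supports stmt-CriticalPhenomena-16772`) and the closing
skeleton file share ONE copy of every object (namespace
`Summit.CriticalPhenomena.SAWScalingLimit.Cruxes.QCIdentification.EightFifthsPrimitive`, the
skeleton's). Nothing in this file is asserted: every `def … : Prop` is a statement to be proved by a
registered stub or derived by the skeleton's proved glue (`projectiveShape_of`,
`hexObservableLimit_of`, `boundaryRigidity_of`); the only theorem is the definitional `sameNode`.
All texts are copied byte-for-byte from the registered skeleton (sha256 `8f8af967…`).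

Sources: H. Duminil-Copin, S. Smirnov, Ann. of Math. 175 (2012) 1653–1665 (arXiv:1007.0575), Lemma 1,
Conjecture 2; S. Smirnov, *Towards conformal invariance of 2D lattice models*, ICM 2006 / arXiv:0708.0032
§5.6 (the primitive `∫ F^{1/σ}`); O. Lehto, K. I. Virtanen, *Quasiconformal mappings in the plane*
(1973) §II.5; K. Astala, T. Iwaniec, G. Martin (2009) Thm 3.9.4, Lemma 5.3.5.
-/
noncomputable section

open scoped BigOperators
open Literature.Probability.LatticeModels Literature.Probability.RandomPlanarGeometry
open Literature.Probability.RandomPlanarGeometry.SAW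
open Literature.Barriers.CriticalPhenomena
open Summit.CriticalPhenomena.SAWScalingLimit.Theses.SAWDevelopingMap

namespace Summit.CriticalPhenomena.SAWScalingLimit.Cruxes.QCIdentification.EightFifthsPrimitive

/-! ## 0. One node: this crux IS the sibling crux (definitional, no `sorry`) -/

/-- The item stmt-16772 is the δ-unfolding of stmt-8298. -/
theorem sameNode :
    Summit.CriticalPhenomena.SAWScalingLimit.Theses.SAWSpinMonotone.QCIdentification ↔
      Summit.CriticalPhenomena.SAWScalingLimit.Theses.SAWDevelopingMap.QCIdentification :=
  Iff.rfl

/-! ## A. Shared objects — copied VERBATIM from `Lines/birth_SAWSpinMonotone.lean` §A (so that the four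
shared stub signatures are textually identical to the registered birth cut; `Iff.rfl` bridges) -/

/-- The critical observable of the route, abbreviated: `F = F(a, ·, x_c, 5/8)` of the domain `Λ`. -/
abbrev Fobs (Λ : Finset HexVertex) (a : Sym2 HexVertex) : Sym2 HexVertex → ℂ :=
  hexParafermionicObservable Λ a hexCriticalFugacity (5 / 8)

/-- The three neighbours of a hexagonal-lattice vertex, explicitly (up face `(x,0)`: `(x,1), (x-e₀,1),
(x-e₁,1)`; down face `(y,1)`: `(y,0), (y+e₀,0), (y+e₁,0)`), in counterclockwise order of the mid-edges. -/
def hexNbr (v : HexVertex) (k : Fin 3) : HexVertex :=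
  if v.2 = 0 then
    ![(v.1, 1), (v.1 - Pi.single 0 1, 1), (v.1 - Pi.single 1 1, 1)] k
  else
    ![(v.1, 0), (v.1 + Pi.single 0 1, 0), (v.1 + Pi.single 1 1, 0)] k

/-- The `∂H`-mode of a mid-edge function around a vertex: `S(v) = F(p₀) + F(p₁) + F(p₂)` (labelling
independent; `= 6 i √3 ∂H` on the triangle `Δ_v` of the developing map). -/
def modeSum (F : Sym2 HexVertex → ℂ) (v : HexVertex) : ℂ :=
  F s(v, hexNbr v 0) + F s(v, hexNbr v 1) + F s(v, hexNbr v 2)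

/-- **No branching of the developing map.** For every simply connected `Λ`, boundary source `a` and
every site `x` of `𝕋` whose six surrounding faces (the hexagon of `ℍ` centred at `x`) lie in `Λ`, if the
`∂H`-modes around the hexagon are non-zero then the six consecutive argument increments
`arg (S(v_{j+1}) / S(v_j))` (each in `(-π, π]`) sum to `0`: the PL developing map winds exactly once around
`H(x)` (local homeomorphism), never `2, 3, …` times. (The `≠ 0` guards make the disconnected-`Λ` junk
model vacuous, triage r1 S1.) -/
def NoBranching : Prop :=
  ∀ (Λ : Finset HexVertex), hexDomainSimplyConnected Λ → ∀ a ∈ hexDomainBoundary Λ, ∀ x : Site 2,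
    (∀ j : Fin 6, HexKernel.face x j ∈ Λ) →
    (∀ j : Fin 6, modeSum (Fobs Λ a) (HexKernel.face x j) ≠ 0) →
    ∑ j : Fin 6, Complex.arg (modeSum (Fobs Λ a) (HexKernel.face x (j + 1)) /
        modeSum (Fobs Λ a) (HexKernel.face x j)) = 0

/-- **(N1) Lateral universality of the zigzag boundary layer, mesoscopic form.** For every `ε > 0`
there are `η > 0` and `M₀` such that for all `M ≥ M₀`, every simply connected `Λ`, every boundary source
`a`, and every two bottom-boundary vertices `(x,0)`, `(x',0)` of the same row at mutual distance `≤ η M`,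
if `Λ` coincides with the exact zigzag half-plane `{w | x 1 ≤ w.1 1}` within Euclidean radius `M` of
`(x,0)` and `a` is at distance `≥ M`, then the boundary values at the two downward mid-edges agree up to
relative error `ε`. -/
def ZigzagLateralUniversality : Prop :=
  ∀ ε : ℝ, 0 < ε → ∃ η : ℝ, 0 < η ∧ ∃ M₀ : ℝ, ∀ M : ℝ, M₀ ≤ M →
    ∀ (Λ : Finset HexVertex), hexDomainSimplyConnected Λ → ∀ a ∈ hexDomainBoundary Λ, ∀ x x' : Site 2,
      x' 1 = x 1 →
      dist (hexCenter ((x', 0) : HexVertex)) (hexCenter ((x, 0) : HexVertex)) ≤ η * M →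
      (∀ w : HexVertex, dist (hexCenter w) (hexCenter ((x, 0) : HexVertex)) ≤ M → (w ∈ Λ ↔ x 1 ≤ w.1 1)) →
      M ≤ dist (hexMidpoint a) (hexCenter ((x, 0) : HexVertex)) →
      let p : Sym2 HexVertex := s((x, 0), (x - Pi.single 1 1, 1))
      let p' : Sym2 HexVertex := s((x', 0), (x' - Pi.single 1 1, 1))
      ‖Fobs Λ a p - Fobs Λ a p'‖ ≤ ε * ‖Fobs Λ a p'‖

/-- **Admissible data** — verbatim the hypotheses of the target `HexObservableLimit` on
`(D, ρ, Λ_·, m, a_·, b_·, Φ, L, L_b)` (everything except the test function): a Dobrushin domain flat in the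
`ρ`-balls at both marked points, an eventually admissible discretisation family with exact half-lattice
rows in both balls, exhausting compacts, `a_δ → a`, `b_δ → b`, `Φ : Ω → ℍ` with `a ↦ ∞`, `b ↦ 0`,
`L = log Φ′` continuous on `Ω` with limit `L_b` at `b`. -/
def Admissible (D : DobrushinDomain) (ρ : ℝ) (Λ : ℝ → Finset HexVertex) (m : Fin 2 → ℝ → ℤ)
    (a b : ℝ → Sym2 HexVertex) (Φ : ConformalEquiv D.carrier UpperHalfPlane.upperHalfPlaneSet)
    (L : ℂ → ℂ) (Lb : ℂ) : Prop :=
  0 < ρ ∧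
  (∀ i : Fin 2, D.carrier ∩ Metric.ball (D.pt i) ρ = {z : ℂ | (D.pt i).im < z.im} ∩ Metric.ball (D.pt i) ρ) ∧
  (∀ᶠ δ : ℝ in nhdsWithin 0 (Set.Ioi 0),
    hexDomainSimplyConnected (Λ δ) ∧ a δ ∈ hexDomainBoundary (Λ δ) ∧ b δ ∈ hexDomainBoundary (Λ δ) ∧
    Nonempty (HexMidEdgeSAW (Λ δ) (a δ) (b δ)) ∧
    (hexGraph.induce ((Λ δ : Finset HexVertex) : Set HexVertex)).Preconnected ∧
    (∀ v ∈ Λ δ, (δ : ℂ) * hexCenter v ∈ D.carrier) ∧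
    (∀ i : Fin 2, ∀ v : HexVertex, (δ : ℂ) * hexCenter v ∈ Metric.ball (D.pt i) ρ →
      (v ∈ Λ δ ↔ m i δ ≤ v.1 1))) ∧
  (∀ K : Set ℂ, IsCompact K → K ⊆ D.carrier → ∀ᶠ δ : ℝ in nhdsWithin 0 (Set.Ioi 0),
    ∀ v : HexVertex, (δ : ℂ) * hexCenter v ∈ K → v ∈ Λ δ) ∧
  Filter.Tendsto (fun δ : ℝ => (δ : ℂ) * hexMidpoint (a δ)) (nhdsWithin 0 (Set.Ioi 0)) (nhds (D.pt 0)) ∧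
  Filter.Tendsto (fun δ : ℝ => (δ : ℂ) * hexMidpoint (b δ)) (nhdsWithin 0 (Set.Ioi 0)) (nhds (D.pt 1)) ∧
  Filter.Tendsto (fun x => ‖Φ x‖) (nhdsWithin (D.pt 0) D.carrier) Filter.atTop ∧
  Φ.HasBoundaryValue (D.pt 1) 0 ∧
  ContinuousOn L D.carrier ∧
  (∀ z ∈ D.carrier, Complex.exp (L z) = deriv Φ z) ∧
  Filter.Tendsto L (nhdsWithin (D.pt 1) D.carrier) (nhds Lb)

/-- The `ψ`-averaged observable at mesh `δ`: `A_δ(ψ) = δ² Σ_{e ∈ Ω_δ} ψ(δ m_e) F_δ(e)` — verbatim the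
numerator of the target. -/
def bulkAverage (Λ : ℝ → Finset HexVertex) (a : ℝ → Sym2 HexVertex) (ψ : ℂ → ℂ) (δ : ℝ) : ℂ :=
  (δ : ℂ) ^ 2 * ∑ᶠ e ∈ hexDomainMidEdges (Λ δ), ψ ((δ : ℂ) * hexMidpoint e) * Fobs (Λ δ) (a δ) e

/-- The limit shape functional `I(ψ) = ∫ ψ(z) e^{(5/8)(L z − L_b)} dz` — verbatim the target's limit
without the constant `c`. -/
def shapeIntegral (L : ℂ → ℂ) (Lb : ℂ) (ψ : ℂ → ℂ) : ℂ :=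
  ∫ z, ψ z * Complex.exp ((5 / 8 : ℂ) * (L z - Lb))

/-- **Subsequential projective limits exist, holomorphic and non-degenerate** (qc compactness +
holomorphy, macroscopic normalisation). -/
def SubsequentialLimits : Prop :=
  ∀ (D : DobrushinDomain) (ρ : ℝ) (Λ : ℝ → Finset HexVertex) (m : Fin 2 → ℝ → ℤ)
    (a b : ℝ → Sym2 HexVertex) (Φ : ConformalEquiv D.carrier UpperHalfPlane.upperHalfPlaneSet)
    (L : ℂ → ℂ) (Lb : ℂ), Admissible D ρ Λ m a b Φ L Lb →
    ∀ δs : ℕ → ℝ, Filter.Tendsto δs Filter.atTop (nhdsWithin 0 (Set.Ioi 0)) →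
      ∃ φ : ℕ → ℕ, StrictMono φ ∧ ∃ ν : ℕ → ℂ, ∃ g : ℂ → ℂ,
        DifferentiableOn ℂ g D.carrier ∧ (∃ z ∈ D.carrier, g z ≠ 0) ∧
        ∀ ψ : ℂ → ℂ, Continuous ψ → HasCompactSupport ψ → tsupport ψ ⊆ D.carrier →
          Filter.Tendsto (fun n => ν n * bulkAverage Λ a ψ (δs (φ n))) Filter.atTop
            (nhds (∫ z, ψ z * g z))

/-- **Boundary rigidity (identification of subsequential limits).** For admissible data, every
continuous, somewhere non-zero density `g` on `Ω` that is a projective limit of the bulk averages along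
some sequence `δ_n → 0⁺` is a constant multiple of `e^{(5/8)(L − L_b)} = (φ′/φ′(b))^{5/8}`. -/
def BoundaryRigidity : Prop :=
  ∀ (D : DobrushinDomain) (ρ : ℝ) (Λ : ℝ → Finset HexVertex) (m : Fin 2 → ℝ → ℤ)
    (a b : ℝ → Sym2 HexVertex) (Φ : ConformalEquiv D.carrier UpperHalfPlane.upperHalfPlaneSet)
    (L : ℂ → ℂ) (Lb : ℂ), Admissible D ρ Λ m a b Φ L Lb →
    ∀ g : ℂ → ℂ, ContinuousOn g D.carrier → (∃ z ∈ D.carrier, g z ≠ 0) →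
      (∃ δs : ℕ → ℝ, Filter.Tendsto δs Filter.atTop (nhdsWithin 0 (Set.Ioi 0)) ∧ ∃ ν : ℕ → ℂ,
        ∀ ψ : ℂ → ℂ, Continuous ψ → HasCompactSupport ψ → tsupport ψ ⊆ D.carrier →
          Filter.Tendsto (fun n => ν n * bulkAverage Λ a ψ (δs n)) Filter.atTop
            (nhds (∫ z, ψ z * g z))) →
      ∃ c : ℂ, ∀ z ∈ D.carrier, g z = c * Complex.exp ((5 / 8 : ℂ) * (L z - Lb))

/-- **Projective shape convergence (subsequential form).** For admissible data every sequence
`δ_n → 0⁺` has a subsequence along which suitably normalised bulk averages converge to `I(ψ)` for every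
test function `ψ`. Derived below from `SubsequentialLimits` + `BoundaryRigidity` (`projectiveShape_of`). -/
def ProjectiveShape : Prop :=
  ∀ (D : DobrushinDomain) (ρ : ℝ) (Λ : ℝ → Finset HexVertex) (m : Fin 2 → ℝ → ℤ)
    (a b : ℝ → Sym2 HexVertex) (Φ : ConformalEquiv D.carrier UpperHalfPlane.upperHalfPlaneSet)
    (L : ℂ → ℂ) (Lb : ℂ), Admissible D ρ Λ m a b Φ L Lb →
    ∀ δs : ℕ → ℝ, Filter.Tendsto δs Filter.atTop (nhdsWithin 0 (Set.Ioi 0)) →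
      ∃ φ : ℕ → ℕ, StrictMono φ ∧ ∃ ν : ℕ → ℂ,
        ∀ ψ : ℂ → ℂ, Continuous ψ → HasCompactSupport ψ → tsupport ψ ⊆ D.carrier →
          Filter.Tendsto (fun n => ν n * bulkAverage Λ a ψ (δs (φ n))) Filter.atTop
            (nhds (shapeIntegral L Lb ψ))

/-- **Boundary amplitude (the normaliser).** One universal `κ ≠ 0`: for admissible data, whenever
normalisers `ν_n` make the bulk averages converge to the shape `I(ψ)` along `δ_n → 0⁺`, the same `ν_n`
make the boundary value at `b_{δ_n}` converge to `κ`. -/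
def BoundaryAmplitude : Prop :=
  ∃ κ : ℂ, κ ≠ 0 ∧
    ∀ (D : DobrushinDomain) (ρ : ℝ) (Λ : ℝ → Finset HexVertex) (m : Fin 2 → ℝ → ℤ)
      (a b : ℝ → Sym2 HexVertex) (Φ : ConformalEquiv D.carrier UpperHalfPlane.upperHalfPlaneSet)
      (L : ℂ → ℂ) (Lb : ℂ), Admissible D ρ Λ m a b Φ L Lb →
      ∀ δs : ℕ → ℝ, Filter.Tendsto δs Filter.atTop (nhdsWithin 0 (Set.Ioi 0)) →
        ∀ ν : ℕ → ℂ,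
          (∀ ψ : ℂ → ℂ, Continuous ψ → HasCompactSupport ψ → tsupport ψ ⊆ D.carrier →
            Filter.Tendsto (fun n => ν n * bulkAverage Λ a ψ (δs n)) Filter.atTop
              (nhds (shapeIntegral L Lb ψ))) →
          Filter.Tendsto (fun n => ν n * Fobs (Λ (δs n)) (a (δs n)) (b (δs n))) Filter.atTop (nhds κ)

/-! ## B. New objects of this line -/

/-- **Exact boundary phase law (eighth-power, branch-free form of the boundary ray).** For every simply
connected `Λ`, every boundary source `a = {u_a, v_a}` (`v_a ∈ Λ`, `u_a ∉ Λ`, adjacent) and every OTHER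
boundary mid-edge `p = {u, v}` (`v ∈ Λ`, `u ∉ Λ`, adjacent):
`F(p)^8 · (c(u) - c(v))^5 = -‖F(p)‖^8 · (c(u_a) - c(v_a))^5`.
Reason: every walk `a → p` has the same winding `W_p = Θ̃_ν(p) - Θ_in(a)` (discrete Umlaufsatz on the
face-disc `K_Λ`), so `F(p) = |F(p)| e^{-i(5/8)W_p}`, `F(p)^8 = |F|^8 e^{-5iW_p}`, and
`e^{-5iΘ̃_ν(p)} (c u - c v)^5 > 0`, `e^{5iΘ_in(a)} = -e^{5iθ_ν(a)}`. (`p = a` is the one exception: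
`F(a) = 1`.) Disconnected `Λ` are harmless (`F = 0` off the source component: `0 = 0`). Equivalent
reading: the 1-form `F^{8/5} dz` lies on ONE ray `i e^{iΘ_in(a)} ℝ_{≥0}` along the whole boundary of
`K_Λ`, whatever the microstructure. Checked by exact enumeration (rel. error ≤ 2e-13, 15 domains). -/
def BoundaryPhaseLaw : Prop :=
  ∀ (Λ : Finset HexVertex), hexDomainSimplyConnected Λ →
    ∀ ua va : HexVertex, va ∈ Λ → ua ∉ Λ → hexGraph.Adj va ua →
    ∀ u v : HexVertex, v ∈ Λ → u ∉ Λ → hexGraph.Adj v u → s(u, v) ≠ s(ua, va) →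
      Fobs Λ s(ua, va) s(u, v) ^ 8 * (hexCenter u - hexCenter v) ^ 5 =
        -((‖Fobs Λ s(ua, va) s(u, v)‖ : ℂ) ^ 8) * (hexCenter ua - hexCenter va) ^ 5

/-- **Ray solution of the spin-5/8 Smirnov boundary problem** on the open set `Ω` with uniformising
coordinate `Φ : Ω → ℍ` (root `a ↦ ∞`): `g = exp ∘ ℓ` for a holomorphic `ℓ`; a holomorphic primitive
`G` of `g^{8/5} := exp((8/5)ℓ)`; RAY BOUNDARY VALUES — `Im(e^{-iθ}G) → κ` as `Φ z → t`, for every real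
`t` (every boundary prime end except the root); and LINEAR GROWTH at the root, `‖G‖ ≤ C(1 + ‖Φ‖)`. -/
def RaySolution (Ω : Set ℂ) (Φ : ℂ → ℂ) (g : ℂ → ℂ) : Prop :=
  ∃ (ℓ G : ℂ → ℂ) (θ κ C : ℝ),
    DifferentiableOn ℂ ℓ Ω ∧ (∀ z ∈ Ω, Complex.exp (ℓ z) = g z) ∧
    DifferentiableOn ℂ G Ω ∧ (∀ z ∈ Ω, deriv G z = Complex.exp ((8 / 5 : ℂ) * ℓ z)) ∧
    (∀ t ε : ℝ, 0 < ε → ∃ η : ℝ, 0 < η ∧ ∀ z ∈ Ω, ‖Φ z - t‖ < η →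
      |(Complex.exp (-(θ * Complex.I)) * G z).im - κ| < ε) ∧
    (∀ z ∈ Ω, ‖G z‖ ≤ C * (1 + ‖Φ z‖))

/-- **Ray condition (the boundary-value identification in Smirnov form).** For admissible data,
every continuous, somewhere non-zero density `g` on `Ω` that is a projective limit of the bulk averages
along some `δ_n → 0⁺` is a `RaySolution`. Same hypotheses as the birth line's `BoundaryRigidity`; the
conclusion names no shape, no constant `c`, no `F(b_δ)`. THE HARD STUB'S TARGET: lattice side = (R) +
branch consistency (`NoBranching`, (K)) + the second-order layer analysis of `F^{8/5}dz` under (M)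
("zero twist" = layer circulation parallel to the ray) + the 45°-wedge normal form at the pinned root. -/
def RayCondition : Prop :=
  ∀ (D : DobrushinDomain) (ρ : ℝ) (Λ : ℝ → Finset HexVertex) (m : Fin 2 → ℝ → ℤ)
    (a b : ℝ → Sym2 HexVertex) (Φ : ConformalEquiv D.carrier UpperHalfPlane.upperHalfPlaneSet)
    (L : ℂ → ℂ) (Lb : ℂ), Admissible D ρ Λ m a b Φ L Lb →
    ∀ g : ℂ → ℂ, ContinuousOn g D.carrier → (∃ z ∈ D.carrier, g z ≠ 0) →
      (∃ δs : ℕ → ℝ, Filter.Tendsto δs Filter.atTop (nhdsWithin 0 (Set.Ioi 0)) ∧ ∃ ν : ℕ → ℂ,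
        ∀ ψ : ℂ → ℂ, Continuous ψ → HasCompactSupport ψ → tsupport ψ ⊆ D.carrier →
          Filter.Tendsto (fun n => ν n * bulkAverage Λ a ψ (δs n)) Filter.atTop
            (nhds (∫ z, ψ z * g z))) →
      RaySolution D.carrier Φ g

/-- **Ray rigidity (pure complex analysis, provable now).** For admissible data, every `RaySolution g`
is a constant multiple of `e^{(5/8)(L - L_b)} = (Φ'/Φ'(b))^{5/8}`. Proof sketch: `Q := e^{-iθ}G∘Φ⁻¹ - iκ`
is holomorphic on `ℍ` with `Im Q → 0` at every real point, so extends to an entire function by Schwarz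
reflection; `|Q| ≤ C'(1 + |w|)` gives `Q = αw + β` (`α, β ∈ ℝ`, `α ≠ 0` since `Q' = e^{-iθ}g^{8/5}/Φ' ≠ 0`);
hence `exp((8/5)ℓ) = αe^{iθ} exp(L)` on the connected `Ω`, `ℓ = (5/8)L + const`, `g = c e^{(5/8)(L-L_b)}`. -/
def RayRigidity : Prop :=
  ∀ (D : DobrushinDomain) (ρ : ℝ) (Λ : ℝ → Finset HexVertex) (m : Fin 2 → ℝ → ℤ)
    (a b : ℝ → Sym2 HexVertex) (Φ : ConformalEquiv D.carrier UpperHalfPlane.upperHalfPlaneSet)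
    (L : ℂ → ℂ) (Lb : ℂ), Admissible D ρ Λ m a b Φ L Lb →
    ∀ g : ℂ → ℂ, RaySolution D.carrier Φ g →
      ∃ c : ℂ, ∀ z ∈ D.carrier, g z = c * Complex.exp ((5 / 8 : ℂ) * (L z - Lb))

/-! The seven stub statements as NAMED propositions (playbook pattern `Sig.stub_*`): the skeleton
audit admits a hypothesis of the composing theorem only if its head constant names a declared stub. Each
`Sig.stub_X` is an `abbrev` for exactly the registered signature of `stub_X` (definitional, transparent). -/
namespace Sig

/-- Registered signature of `stub_noBranching` (shared with the birth cuts). -/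
abbrev stub_noBranching : Prop := NoFoldBound → NoBranching

/-- Registered signature of `stub_subsequentialLimits` (shared with the birth cuts). -/
abbrev stub_subsequentialLimits : Prop :=
  NoBranching → NoFoldBound → InteriorFlattening → SubsequentialLimits

/-- Registered signature of `stub_boundaryPhaseLaw`. -/
abbrev stub_boundaryPhaseLaw : Prop := BoundaryPhaseLaw

/-- Registered signature of `stub_rayCondition` (the hardest stub of the line). -/
abbrev stub_rayCondition : Prop :=
  BoundaryPhaseLaw → NoBranching → NoFoldBound → InteriorFlattening → RayCondition

/-- Registered signature of `stub_rayRigidity`. -/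
abbrev stub_rayRigidity : Prop := RayRigidity

/-- Registered signature of `stub_lateralUniversality` (shared with the birth cuts). -/
abbrev stub_lateralUniversality : Prop := ZigzagLateralUniversality

/-- Registered signature of `stub_boundaryAmplitude` (shared with the birth cuts). -/
abbrev stub_boundaryAmplitude : Prop :=
  NoBranching → NoFoldBound → InteriorFlattening → ZigzagLateralUniversality → BoundaryAmplitude

end Sig

end Summit.CriticalPhenomena.SAWScalingLimit.Cruxes.QCIdentification.EightFifthsPrimitive
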